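import Literature.NumberTheory.GaloisRepresentations.KummerLayerRound
import HarnessLib

/-!
# Transfer of the splitting and total-reality conditions through a Hecke–Kummer round

Topic `NumberTheory/GaloisRepresentations`; theorems only (no definition, no named fact).  In the
notation of `KummerLayerRound.exists_layer` (`k ⊆ K̄` finite Galois over the number field `K`,
`M/k` the Galois layer of prime degree `ℓ`, `M ⊆ k(ζ, α)`):

* `forall_smul_conj_eq_of_layer` — if `k` is split at the place `u` (all of `Γ_{K_u}` fixes
  `ι_u k`) and `ι_u (γ α) ^ ℓ` is the `ℓ`-th power of an element fixed by the stabiliser `Z_u`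
  of `ι_u ζ`, then `Γ_{K_u}` fixes `ι_u (γ M)`: `Z_u` fixes `ι_u (γ M)` directly, so the index of
  the local group of `γ M` divides both `[Γ_{K_u} : Z_u] ∣ ℓ - 1` and `[Gal(K̄/k) : Gal(K̄/γM)] = ℓ`.
* `isReal_of_layer` — if `k` is totally real and `ρ A > 0` at the real embeddings `ρ` of `k(ζ)`,
  then `M` is totally real: for odd `ℓ`, complex conjugation composed with an embedding of `M`
  differs from it by an element of order dividing `2` of `Gal(M/k)`, which has odd order; for
  `ℓ = 2`, `M = k(α)` with `α² = A` positive at every real place.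

## References

* H. Cohen, P. Stevenhagen, *Computational class field theory*, MSRI Publ. 44 (2008), §5;
  J. Neukirch, *Algebraic Number Theory*, VI §1. [cite: BuhlerStevenhagen2008, §5 p. 532]
-/

noncomputable section

open scoped NumberField IntermediateField Valued ComplexConjugate
open Field IsDedekindDomain IntermediateField
open Literature.FieldTheory.Kummer Literature.FieldTheory.Galois

universe u

namespace Literature.NumberTheory.GaloisRepresentations

variable (K : Type u) [Field K] [NumberField K]

/-! ### Splitting of the conjugates of the layer -/

/-- **Splitting transfer.**  See the module docstring. [cite: BuhlerStevenhagen2008, §5 p. 532] -/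
theorem forall_smul_conj_eq_of_layer (u : HeightOneSpectrum (𝓞 K))
    (k : IntermediateField K (AlgebraicClosure K)) [IsGalois K k]
    {ℓ : ℕ} (hℓ : ℓ.Prime) {ζg α : AlgebraicClosure K} (hζg : IsPrimitiveRoot ζg ℓ)
    (M : IntermediateField (↥k) (AlgebraicClosure K)) (hMle : M ≤ (↥k)⟮ζg, α⟯)
    [FiniteDimensional (↥k) M] [IsGalois (↥k) M] (hMrank : Module.finrank (↥k) M = ℓ)
    (hsplit : ∀ (σ : absoluteGaloisGroup (u.adicCompletion K)), ∀ x ∈ k,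
      σ • absClosureEmbedding K (u.adicCompletion K) x = absClosureEmbedding K (u.adicCompletion K) x)
    (γ : absoluteGaloisGroup K)
    (hz : ∃ z : AlgebraicClosure (u.adicCompletion K),
      (∀ σ : absoluteGaloisGroup (u.adicCompletion K),
        σ • absClosureEmbedding K (u.adicCompletion K) ζg =
          absClosureEmbedding K (u.adicCompletion K) ζg → σ • z = z) ∧
      absClosureEmbedding K (u.adicCompletion K) (γ • α) ^ ℓ = z ^ ℓ) :
    ∀ (σ : absoluteGaloisGroup (u.adicCompletion K)) (x : AlgebraicClosure K), x ∈ M →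
      σ • absClosureEmbedding K (u.adicCompletion K) (γ • x) =
        absClosureEmbedding K (u.adicCompletion K) (γ • x) := by
  classical
  haveI : NeZero ℓ := ⟨hℓ.ne_zero⟩
  haveI : CharZero (u.adicCompletion K) :=
    charZero_of_injective_algebraMap (algebraMap K _).injective
  haveI hnk : Normal (↥k) (AlgebraicClosure K) :=
    Normal.tower_top_of_normal K (↥k) (AlgebraicClosure K)
  have hζu : IsPrimitiveRoot (absClosureEmbedding K (u.adicCompletion K) ζg) ℓ :=
    hζg.map_of_injective (absClosureEmbedding K (u.adicCompletion K)).injective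
  set Zu : Subgroup (absoluteGaloisGroup (u.adicCompletion K)) :=
    MulAction.stabilizer (absoluteGaloisGroup (u.adicCompletion K))
      (absClosureEmbedding K (u.adicCompletion K) ζg) with hZudef
  have hZu : ∀ σ, σ ∈ Zu ↔ σ • absClosureEmbedding K (u.adicCompletion K) ζg =
      absClosureEmbedding K (u.adicCompletion K) ζg := fun σ => MulAction.mem_stabilizer_iff
  -- Step 1: `Z_u` fixes `ι_u (γ M)`
  have hstep1 : ∀ σ ∈ Zu, ∀ x : AlgebraicClosure K, x ∈ M →
      σ • absClosureEmbedding K (u.adicCompletion K) (γ • x) =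
        absClosureEmbedding K (u.adicCompletion K) (γ • x) := by
    intro σ hσ x hx
    have hσζ : σ • absClosureEmbedding K (u.adicCompletion K) ζg =
        absClosureEmbedding K (u.adicCompletion K) ζg := (hZu σ).1 hσ
    refine forall_mem_adjoin_smul_eq K k {ζg, α}
      (((absClosureEmbedding K (u.adicCompletion K) : AlgebraicClosure K →+*
        AlgebraicClosure (u.adicCompletion K))).comp
        ((absoluteGaloisGroup.toAlgEquiv K γ : AlgebraicClosure K ≃ₐ[K] AlgebraicClosure K) :
          AlgebraicClosure K →+* AlgebraicClosure K)) σ (fun y hy => ?_) (fun y hy => ?_) x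
      (hMle hx)
    · exact hsplit σ (γ • y) (smul_mem_of_normal k γ hy)
    · change σ • absClosureEmbedding K (u.adicCompletion K) (γ • y) =
        absClosureEmbedding K (u.adicCompletion K) (γ • y)
      rcases hy with hy | hy
      · rw [hy]
        obtain ⟨n, hn⟩ := exists_smul_eq_pow K hℓ hζg γ
        rw [hn, map_pow, smul_pow', hσζ]
      · rw [Set.mem_singleton_iff] at hy
        rw [hy]
        obtain ⟨z, hz, hzα⟩ := hz
        by_cases h0 : absClosureEmbedding K (u.adicCompletion K) (γ • α) = 0
        · rw [h0, smul_zero]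
        · have hz0 : z ≠ 0 := by
            rintro rfl
            rw [zero_pow hℓ.ne_zero] at hzα
            exact h0 (pow_eq_zero_iff hℓ.ne_zero |>.1 hzα)
          obtain ⟨i, -, hi⟩ := exists_eq_pow_mul_of_pow_eq hζu hz0 hzα
          rw [hi, smul_mul', smul_pow', hσζ, hz σ hσζ]
  -- Step 2: the local group `X_u` of `γ M` as a preimage
  set g : AlgebraicClosure K ≃ₐ[K] AlgebraicClosure K := absoluteGaloisGroup.toAlgEquiv K γ
    with hg
  set f' : absoluteGaloisGroup (u.adicCompletion K) →*
      (AlgebraicClosure K ≃ₐ[K] AlgebraicClosure K) :=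
    (absoluteGaloisGroup.toAlgEquiv K).toMonoidHom.comp
      (absGaloisRestrict K (u.adicCompletion K)).toMonoidHom with hf'
  set f'' : absoluteGaloisGroup (u.adicCompletion K) →*
      (AlgebraicClosure K ≃ₐ[K] AlgebraicClosure K) :=
    (MulAut.conj g⁻¹).toMonoidHom.comp f' with hf''
  have hf''apply : ∀ σ, f'' σ = g⁻¹ * f' σ * g := fun σ => by
    change g⁻¹ * f' σ * g⁻¹⁻¹ = _
    rw [inv_inv]
  set Xu : Subgroup (absoluteGaloisGroup (u.adicCompletion K)) :=
    (M.restrictScalars K).fixingSubgroup.comap f'' with hXu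
  have hXumem : ∀ σ, σ ∈ Xu ↔ ∀ x : AlgebraicClosure K, x ∈ M →
      σ • absClosureEmbedding K (u.adicCompletion K) (γ • x) =
        absClosureEmbedding K (u.adicCompletion K) (γ • x) := by
    intro σ
    rw [hXu, Subgroup.mem_comap, mem_fixingSubgroup_restrictScalars_iff]
    refine forall₂_congr fun x _ => ?_
    rw [hf''apply, AlgEquiv.mul_apply, AlgEquiv.mul_apply,
      show (g⁻¹ : AlgebraicClosure K ≃ₐ[K] AlgebraicClosure K) = g.symm from rfl,
      AlgEquiv.symm_apply_eq]
    change absGaloisRestrict K (u.adicCompletion K) σ • (γ • x) = γ • x ↔ _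
    constructor
    · intro h
      rw [← absGaloisRestrict_apply_smul, h]
    · intro h
      exact (absClosureEmbedding K (u.adicCompletion K)).injective
        ((absGaloisRestrict_apply_smul K (u.adicCompletion K) σ (γ • x)).trans h)
  -- Step 3: indices
  have hZX : Zu ≤ Xu := fun σ hσ => (hXumem σ).2 (hstep1 σ hσ)
  have hdvd1 : Xu.relIndex ⊤ ∣ ℓ - 1 :=
    (Subgroup.relIndex_dvd_of_le_left ⊤ hZX).trans
      (relIndex_dvd_sub_one (u.adicCompletion K) hℓ hζu Zu hZu ⊤)
  have hdvd2 : Xu.relIndex ⊤ ∣ ℓ := by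
    have hkn : k.fixingSubgroup.Normal := inferInstance
    have htop : k.fixingSubgroup.comap f'' = ⊤ := by
      rw [eq_top_iff]
      intro σ _
      rw [Subgroup.mem_comap, hf''apply]
      have hf'σ : f' σ ∈ k.fixingSubgroup :=
        (absGaloisRestrict_mem_fixingSubgroup_iff K u k σ).2
          ((forall_smul_absClosureEmbedding_eq_iff K u k σ).1 (hsplit σ))
      exact hkn.conj_mem' (f' σ) hf'σ g
    rw [← htop, ← hMrank, ← relIndex_fixingSubgroup_restrictScalars_eq_finrank k M, hXu]
    refine relIndex_comap_dvd f'' (fun τ hτ => ?_) (fun a' ha' b' hb' =>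
      conj_mem_fixingSubgroup_of_normal K k M ha' hb')
    rw [IntermediateField.mem_fixingSubgroup_iff] at hτ ⊢
    exact fun x hx => hτ x (IntermediateField.algebraMap_mem M (⟨x, hx⟩ : k))
  have hone : Xu.relIndex ⊤ = 1 := by
    have h := Nat.dvd_sub hdvd2 hdvd1
    rw [Nat.sub_sub_self hℓ.one_lt.le] at h
    exact Nat.dvd_one.1 h
  have htop' : (⊤ : Subgroup (absoluteGaloisGroup (u.adicCompletion K))) ≤ Xu :=
    Subgroup.relIndex_eq_one.1 hone
  intro σ x hx
  exact (hXumem σ).1 (htop' (Subgroup.mem_top σ)) x hx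

/-! ### Total reality of the layer -/

/-- **Odd-degree Galois extensions of totally real fields are totally real** (in the embedding
form): if every embedding `k → ℂ` is real and `M/k` is Galois of odd degree, every embedding
`M → ℂ` is real — complex conjugation composed with `φ` is `φ ∘ g` for some `g ∈ Gal(M/k)` with
`g² = 1`. [folklore] -/
theorem isReal_of_isGalois_of_odd {k M : Type*} [Field k] [Field M] [Algebra k M]
    [FiniteDimensional k M] [IsGalois k M] (hodd : Odd (Module.finrank k M))
    (hk : ∀ φ : k →+* ℂ, NumberField.ComplexEmbedding.IsReal φ) (φ : M →+* ℂ) :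
    NumberField.ComplexEmbedding.IsReal φ := by
  letI : Algebra M ℂ := φ.toAlgebra
  letI : Algebra k ℂ := (φ.comp (algebraMap k M)).toAlgebra
  haveI : IsScalarTower k M ℂ := IsScalarTower.of_algebraMap_eq fun _ => rfl
  have hreal : ∀ x : k, conj (φ (algebraMap k M x)) = φ (algebraMap k M x) := fun x => by
    have h := hk (φ.comp (algebraMap k M))
    rw [NumberField.ComplexEmbedding.isReal_iff] at h
    exact RingHom.congr_fun h x
  let ψ : M →ₐ[k] ℂ :=
    { (starRingEnd ℂ).comp φ with commutes' := fun x => hreal x }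
  set g : M ≃ₐ[k] M := ψ.restrictNormal' M with hgdef
  have hg : ∀ x : M, φ (g x) = conj (φ x) := fun x => by
    have h := AlgHom.restrictNormal_commutes ψ M x
    exact h
  have hg2 : g * g = 1 := by
    ext x
    apply φ.injective
    rw [AlgEquiv.mul_apply, hg, hg, Complex.conj_conj, AlgEquiv.one_apply]
  have hord : orderOf g ∣ 2 := orderOf_dvd_of_pow_eq_one (by rw [pow_two, hg2])
  have hord' : orderOf g ∣ Module.finrank k M := by
    rw [← IsGalois.card_aut_eq_finrank]
    exact orderOf_dvd_natCard g
  have h1 : orderOf g = 1 := by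
    rcases (Nat.dvd_prime Nat.prime_two).1 hord with h | h
    · exact h
    · exfalso
      rw [h] at hord'
      exact (Nat.not_even_iff_odd.2 hodd) (even_iff_two_dvd.2 hord')
  have hg1 : g = 1 := orderOf_eq_one_iff.1 h1
  rw [NumberField.ComplexEmbedding.isReal_iff]
  ext x
  change conj (φ x) = φ x
  rw [← hg, hg1, AlgEquiv.one_apply]

/-- A complex number whose square is a positive real is real. [folklore] -/
theorem conj_eq_of_sq_eq_ofReal {w : ℂ} {r : ℝ} (hr : 0 < r) (hw : w ^ 2 = (r : ℂ)) :
    conj w = w := by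
  rw [Complex.conj_eq_iff_im]
  have h1 := congrArg Complex.im hw
  have h2 := congrArg Complex.re hw
  simp only [sq, Complex.mul_im, Complex.ofReal_im, Complex.mul_re, Complex.ofReal_re] at h1 h2
  by_contra him
  have hre : w.re = 0 := by
    have : 2 * (w.re * w.im) = 0 := by linarith
    rcases mul_eq_zero.1 this with h | h
    · norm_num at h
    · exact (mul_eq_zero.1 h).resolve_right him
  rw [hre] at h2
  nlinarith [sq_nonneg w.im]

/-- **The case `ℓ = 2`.**  `M = k(α)` with `α² = A ∈ k(ζ) = k` positive at every real place,
over a totally real `k`, is totally real. [folklore] -/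
theorem isReal_of_layer_two (k : IntermediateField K (AlgebraicClosure K))
    {ζg α : AlgebraicClosure K} (hζg : IsPrimitiveRoot ζg 2)
    (M : IntermediateField (↥k) (AlgebraicClosure K)) (hMle : M ≤ (↥k)⟮ζg, α⟯)
    (hMsup : (↥k)⟮ζg⟯ ⊔ M = (↥k)⟮ζg, α⟯)
    (hA : α ^ 2 ∈ (↥k)⟮ζg⟯) (hpos : ∀ ρ : (↥k)⟮ζg⟯ →+* ℝ, 0 < ρ ⟨α ^ 2, hA⟩)
    (hk : ∀ φ : ↥k →+* ℂ, NumberField.ComplexEmbedding.IsReal φ) (φ : ↥M →+* ℂ) :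
    NumberField.ComplexEmbedding.IsReal φ := by
  have hζ1 : ζg = -1 := hζg.eq_neg_one_of_two_right
  -- `k(ζ) = k ≤ M` and `M = k(ζ, α)`
  have hkζbot : (↥k)⟮ζg⟯ ≤ ⊥ := by
    rw [IntermediateField.adjoin_le_iff, Set.singleton_subset_iff, hζ1]
    exact neg_mem (one_mem _)
  have hkζM : (↥k)⟮ζg⟯ ≤ M := hkζbot.trans bot_le
  have hMeq : M = (↥k)⟮ζg, α⟯ := le_antisymm hMle (hMsup ▸ sup_le hkζM le_rfl)
  have hαM : α ∈ M := hMeq ▸ IntermediateField.subset_adjoin _ _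
    (Set.mem_insert_of_mem _ (Set.mem_singleton α))
  -- embeddings of `k(ζ) = k` are real
  have hkζreal : ∀ ψ : (↥k)⟮ζg⟯ →+* ℂ, NumberField.ComplexEmbedding.IsReal ψ := by
    intro ψ
    rw [NumberField.ComplexEmbedding.isReal_iff]
    ext x
    obtain ⟨c, hc⟩ : (x : AlgebraicClosure K) ∈ (⊥ : IntermediateField (↥k) (AlgebraicClosure K)) :=
      hkζbot x.2
    have hx : x = algebraMap (↥k) (↥k)⟮ζg⟯ c := Subtype.ext hc.symm
    have h := hk (ψ.comp (algebraMap (↥k) (↥k)⟮ζg⟯))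
    rw [NumberField.ComplexEmbedding.isReal_iff] at h
    rw [hx]
    exact RingHom.congr_fun h c
  -- the `k`-algebra structure on `ℂ` through `φ`
  letI : Algebra (↥k) ℂ := (φ.comp (algebraMap (↥k) M)).toAlgebra
  have hreal : ∀ x : ↥k, conj (φ (algebraMap (↥k) M x)) = φ (algebraMap (↥k) M x) := fun x => by
    have h := hk (φ.comp (algebraMap (↥k) M))
    rw [NumberField.ComplexEmbedding.isReal_iff] at h
    exact RingHom.congr_fun h x
  let φ₁ : ↥M →ₐ[↥k] ℂ := { (starRingEnd ℂ).comp φ with commutes' := fun x => hreal x }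
  let φ₂ : ↥M →ₐ[↥k] ℂ := { φ with commutes' := fun _ => rfl }
  -- `φ α` is real
  have hφα : conj (φ ⟨α, hαM⟩) = φ ⟨α, hαM⟩ := by
    set ρ : (↥k)⟮ζg⟯ →+* ℂ := φ.comp (IntermediateField.inclusion hkζM) with hρ
    have hρreal := hkζreal ρ
    have h1 : (φ ⟨α, hαM⟩) ^ 2 = ρ ⟨α ^ 2, hA⟩ := by
      rw [hρ, RingHom.comp_apply, ← map_pow]
      rfl
    have h2 : ρ ⟨α ^ 2, hA⟩ = ((hρreal.embedding ⟨α ^ 2, hA⟩ : ℝ) : ℂ) :=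
      (NumberField.ComplexEmbedding.IsReal.coe_embedding_apply hρreal _).symm
    rw [h2] at h1
    exact conj_eq_of_sq_eq_ofReal (hpos hρreal.embedding) h1
  have hneg : ∀ y : ↥M, (y : AlgebraicClosure K) = ζg → conj (φ y) = φ y := by
    intro y hy
    have h1 : y = -1 := Subtype.ext (by simp [hy, hζ1])
    rw [h1, map_neg, map_one, map_neg, map_one]
  have hal : ∀ y : ↥M, (y : AlgebraicClosure K) = α → conj (φ y) = φ y := by
    intro y hy
    have h1 : y = ⟨α, hαM⟩ := Subtype.ext hy
    rw [h1]
    exact hφα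
  have hφ : φ₁ = φ₂ := by
    refine IntermediateField.algHom_ext_of_eq_adjoin (↥k) hMeq fun x hx => ?_
    rcases hx with hx | hx
    · exact hneg _ hx
    · exact hal _ hx
  rw [NumberField.ComplexEmbedding.isReal_iff]
  ext x
  change conj (φ x) = φ x
  exact AlgHom.congr_fun hφ x

/-- **Total reality of the layer.**  In the notation of `exists_layer`: if `k` is totally real
(every embedding `k → ℂ` real) then so is `M`. [cite: BuhlerStevenhagen2008, §5 p. 532] -/
theorem isReal_of_layer (k : IntermediateField K (AlgebraicClosure K)) {ℓ : ℕ} (hℓ : ℓ.Prime)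
    {ζg α : AlgebraicClosure K} (hζg : IsPrimitiveRoot ζg ℓ)
    (M : IntermediateField (↥k) (AlgebraicClosure K)) (hMle : M ≤ (↥k)⟮ζg, α⟯)
    (hMsup : (↥k)⟮ζg⟯ ⊔ M = (↥k)⟮ζg, α⟯) [FiniteDimensional (↥k) M] [IsGalois (↥k) M]
    (hMrank : Module.finrank (↥k) M = ℓ)
    (hA : α ^ ℓ ∈ (↥k)⟮ζg⟯) (hpos : ∀ ρ : (↥k)⟮ζg⟯ →+* ℝ, 0 < ρ ⟨α ^ ℓ, hA⟩)
    (hk : ∀ φ : ↥k →+* ℂ, NumberField.ComplexEmbedding.IsReal φ) (φ : ↥M →+* ℂ) :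
    NumberField.ComplexEmbedding.IsReal φ := by
  rcases hℓ.eq_two_or_odd' with h2 | hodd
  · subst h2
    exact isReal_of_layer_two K k hζg M hMle hMsup hA hpos hk φ
  · exact isReal_of_isGalois_of_odd (hMrank ▸ hodd) hk φ

end Literature.NumberTheory.GaloisRepresentations
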